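import Mathlib
import Literature.NumberTheory.Sieve.LinearEquationsInPrimes
import Summits.Parity.GeneralizedHardyLittlewood.Theorems.LiouvilleShiftedTablesPairsToGHLStubSlopedEulerAux3
import Summits.Parity.GeneralizedHardyLittlewood.Theorems.LiouvilleShiftedTablesPairsToGHLStubSlopedEulerAux4

/-!
# Sloped ladder: `stub_slopedEuler` — the singular-series bookkeeping of the rung

Route `LiouvilleShiftedTables` (Parity / GeneralizedHardyLittlewood), crux stmt-Parity-9389
(`Summit.Parity.GeneralizedHardyLittlewood.Theses.LiouvilleShiftedTables.PairsToGHL`), line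
`sloped_ladder`, registered stub `stub_slopedEuler`.

For `t ≥ 1`, a positive `t`-system `Φᵢ(n) = aᵢ n + cᵢ` and a positive form `ψ(n) = α n + β` with
`vecCons ψ Φ` non-degenerate, the rung of the ladder (`stub_slopedRung`) expands
`Λ(ψ(n)) = -∑_{d ∣ ψ(n)} μ(d) log d` against the tuple weight `∏ᵢ Λ(Φᵢ(n))` and meets the sieve
weight

  `w̃(d) = ∑_{ρ < d'} 𝟙[d ∣ α ρ + β] 𝟙[ρ Φ-admissible mod d'] / #{Φ-admissible classes mod d'}`,

`d' = d/gcd(α, d)`. This file proves the three facts the rung consumes, with one constant `C` and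
for all `x ≥ 2`:

  `|∑_{d ≤ x} μ(d) w̃(d)| ≤ C/(log x)²`, `|∑_{d ≤ x} μ(d) w̃(d) log d| ≤ C`,
  `|𝔖(Φ) ∑_{d ≤ x} μ(d) w̃(d) log d + 𝔖(vecCons ψ Φ)| ≤ C/log x`.

Proof (parts 1–4 in the files `…StubSlopedEulerAux1`–`Aux4`): `w̃` is multiplicative (CRT), so
`G = μ · id · w̃ = b ⋆ μ` with `b = G ⋆ ζ` multiplicative, `b(p^k) = 1 - p w̃(p)`; the exceptional
primes (`p ∣ α`, `p ∣ aᵢ`, `p ∣ α cᵢ - aᵢ β ≠ 0` by non-degeneracy, `p ≤ 2t`) are finitely many and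
elsewhere `|b(p^k)| ≤ 2t/p`, whence `∑_{n ≤ N} |b(n)|/√n ≤ S`; the route's PNT-strength estimates
(`Theorems.PairsFromMAvg.abs_sum_convMoebius_*`) give the first two bounds and
`∑ μ w̃ log → -∑_n b(n)/n` at rate `(log x)⁻¹`; finally `∑_n b(n)/n = ∏_p (p/(p-1))(1 - w̃(p))`
(Euler product) and `β_p(vecCons ψ Φ) = (p/(p-1))(1 - w̃(p)) β_p(Φ)` prime by prime, so
`𝔖(vecCons ψ Φ) = 𝔖(Φ) ∑_n b(n)/n` by the ordered limits (Green–Tao 2010, (1.6)–(1.7)).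

[folklore]
-/

noncomputable section

open Finset Real ArithmeticFunction Filter
open scoped ArithmeticFunction.Moebius ArithmeticFunction.zeta Topology

namespace Summit.Parity.GeneralizedHardyLittlewood.Theorems.PairsToGHL.SlopedLadder

open Literature.NumberTheory.Sieve

variable {t : ℕ}

/-! ### The prime-power bounds for `b(p^k) = 1 - p w̃(p)` -/

/-- **Exceptional primes are bounded.** For the weight `w̃` of the sloped rung with `α ≠ 0`,
`aᵢ ≠ 0` and `α cᵢ - aᵢ β ≠ 0` for all `i`, there are `M ≥ 0` and `P₀` with `|1 - p w̃(p)| ≤ M`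
for every prime `p` and `|1 - p w̃(p)| ≤ M/p` for the primes `p > P₀`. [folklore] -/
theorem exists_prime_bounds (a c : Fin t → ℤ) (α β : ℤ) {W : ℕ → ℝ}
    (hW : ∀ d : ℕ, W d = ∑ ρ ∈ range (d / Int.gcd α d),
      if (d : ℤ) ∣ α * ρ + β then
        (if ∀ i, Int.gcd (a i * ρ + c i) (d / Int.gcd α d : ℕ) = 1 then
          ((#((range (d / Int.gcd α d)).filter (fun ρ' : ℕ =>
            ∀ i, Int.gcd (a i * ρ' + c i) (d / Int.gcd α d : ℕ) = 1)) : ℝ))⁻¹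
        else 0)
      else 0)
    (hα : α ≠ 0) (ha : ∀ i, a i ≠ 0) (hΔ : ∀ i, α * c i - a i * β ≠ 0) :
    ∃ (M : ℝ) (P₀ : ℕ), 0 ≤ M ∧ (∀ p : ℕ, p.Prime → |1 - (p : ℝ) * W p| ≤ M) ∧
      (∀ p : ℕ, p.Prime → P₀ < p → |1 - (p : ℝ) * W p| ≤ M / p) := by
  set P₀ : ℕ := 2 * t + α.natAbs + ∑ i, ((a i).natAbs + (α * c i - a i * β).natAbs) with hP₀
  -- beyond `P₀` nothing exceptional happens
  have hndvd : ∀ {p : ℕ} {x : ℤ}, x ≠ 0 → x.natAbs < p → ¬ (p : ℤ) ∣ x := by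
    intro p x hx hlt h
    exact hx (Int.eq_zero_of_dvd_of_natAbs_lt_natAbs h (by simpa using hlt))
  have hle_i : ∀ i, (a i).natAbs + (α * c i - a i * β).natAbs ≤
      ∑ j, ((a j).natAbs + (α * c j - a j * β).natAbs) := fun i =>
    Finset.single_le_sum (f := fun j => (a j).natAbs + (α * c j - a j * β).natAbs)
      (fun j _ => Nat.zero_le _) (Finset.mem_univ i)
  have hgood : ∀ p : ℕ, p.Prime → P₀ < p → |1 - (p : ℝ) * W p| ≤ 2 * t / p := by
    intro p hp hP
    refine abs_one_sub_mul_weight_le_div a c α β hW hp ?_ (fun i => ?_) (fun i => ?_) (by omega)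
    · exact hndvd hα (by omega)
    · exact hndvd (ha i) (by have := hle_i i; omega)
    · exact hndvd (hΔ i) (by have := hle_i i; omega)
  refine ⟨1 + P₀ + 2 * t, P₀, by positivity, fun p hp => ?_, fun p hp hP => ?_⟩
  · rcases le_or_gt p P₀ with h | h
    · calc |1 - (p : ℝ) * W p| ≤ 1 + p := abs_one_sub_mul_weight_le a c α β hW p
        _ ≤ 1 + P₀ + 2 * t := by
            have : (p : ℝ) ≤ P₀ := by exact_mod_cast h
            have ht : (0 : ℝ) ≤ 2 * t := by positivity
            linarith
    · have hp0 : (1 : ℝ) ≤ p := by exact_mod_cast hp.one_le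
      calc |1 - (p : ℝ) * W p| ≤ 2 * t / p := hgood p hp h
        _ ≤ 2 * t := div_le_self (by positivity) hp0
        _ ≤ 1 + P₀ + 2 * t := by
            have : (0 : ℝ) ≤ P₀ := Nat.cast_nonneg _
            linarith
  · have hp0 : (0 : ℝ) < p := by exact_mod_cast hp.pos
    calc |1 - (p : ℝ) * W p| ≤ 2 * t / p := hgood p hp hP
      _ ≤ (1 + P₀ + 2 * t) / p := by
          gcongr
          have : (0 : ℝ) ≤ P₀ := Nat.cast_nonneg _
          linarith

/-! ### The three bounds for the weight of `(Φ, ψ)` -/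

/-- **The singular-series bookkeeping of the sloped rung** (abstract-coefficient form of
`stub_slopedEuler`): for the weight `w̃` of a positive `t`-system `Φ` and a positive form `ψ` with
`vecCons ψ Φ` non-degenerate there is `C` with, for all `x ≥ 2`,
`|∑_{d ≤ x} μ(d) w̃(d)| ≤ C/(log x)²`, `|∑_{d ≤ x} μ(d) w̃(d) log d| ≤ C` and
`|𝔖(Φ) ∑_{d ≤ x} μ(d) w̃(d) log d + 𝔖(vecCons ψ Φ)| ≤ C/log x`. [folklore] -/
theorem slopedEuler_main (Φ : Fin t → AffLinForm 1) (ψ : AffLinForm 1)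
    (hnd : IsNondegenerateSystem (Matrix.vecCons ψ Φ))
    (hΦ : ∀ i, 0 < (Φ i).coeff 0 ∧ 0 ≤ (Φ i).const) (hψ : 0 < ψ.coeff 0 ∧ 0 ≤ ψ.const)
    (W : ℕ → ℝ)
    (hW : ∀ d : ℕ, W d = ∑ ρ ∈ range (d / Int.gcd (ψ.coeff 0) d),
      if (d : ℤ) ∣ ψ.coeff 0 * ρ + ψ.const then
        (if ∀ i, Int.gcd ((Φ i).coeff 0 * ρ + (Φ i).const) (d / Int.gcd (ψ.coeff 0) d : ℕ) = 1 then
          ((#((range (d / Int.gcd (ψ.coeff 0) d)).filter (fun ρ' : ℕ =>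
            ∀ i, Int.gcd ((Φ i).coeff 0 * ρ' + (Φ i).const) (d / Int.gcd (ψ.coeff 0) d : ℕ) = 1)) :
              ℝ))⁻¹
        else 0)
      else 0) :
    ∃ C : ℝ, ∀ x : ℕ, 2 ≤ x →
      |∑ d ∈ Icc 1 x, (μ d : ℝ) * W d| ≤ C / Real.log x ^ 2 ∧
      |∑ d ∈ Icc 1 x, (μ d : ℝ) * W d * Real.log d| ≤ C ∧
      |singularProduct Φ * (∑ d ∈ Icc 1 x, (μ d : ℝ) * W d * Real.log d) +
          singularProduct (Matrix.vecCons ψ Φ)| ≤ C / Real.log x := by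
  -- the coefficients
  set a : Fin t → ℤ := fun i => (Φ i).coeff 0 with ha
  set c : Fin t → ℤ := fun i => (Φ i).const with hc
  have hWa : ∀ d : ℕ, W d = ∑ ρ ∈ range (d / Int.gcd (ψ.coeff 0) d),
      if (d : ℤ) ∣ ψ.coeff 0 * ρ + ψ.const then
        (if ∀ i, Int.gcd (a i * ρ + c i) (d / Int.gcd (ψ.coeff 0) d : ℕ) = 1 then
          ((#((range (d / Int.gcd (ψ.coeff 0) d)).filter (fun ρ' : ℕ =>
            ∀ i, Int.gcd (a i * ρ' + c i) (d / Int.gcd (ψ.coeff 0) d : ℕ) = 1)) : ℝ))⁻¹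
        else 0)
      else 0 := hW
  have hα0 : ψ.coeff 0 ≠ 0 := hψ.1.ne'
  have ha0 : ∀ i, a i ≠ 0 := fun i => (hΦ i).1.ne'
  have hΔ : ∀ i, ψ.coeff 0 * c i - a i * ψ.const ≠ 0 := fun i => det_ne_zero Φ ψ hnd hα0 i
  -- part 1: arithmetic of the weight
  have hW0 : ∀ d, 0 ≤ W d := weight_nonneg a c (ψ.coeff 0) ψ.const hWa
  have hW1 : ∀ d, W d ≤ 1 := weight_le_one a c (ψ.coeff 0) ψ.const hWa
  have hWone : W 1 = 1 := weight_one a c (ψ.coeff 0) ψ.const hWa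
  have hWmul : ∀ m n : ℕ, 0 < m → 0 < n → m.Coprime n → W (m * n) = W m * W n :=
    fun m n hm hn hmn => weight_mul a c (ψ.coeff 0) ψ.const hWa hm hn hmn
  -- part 2: the weights `G`, `b` and the uniform bound
  obtain ⟨G, b, -, hbm, hG, hbμ, hbp⟩ := exists_weights_of_mul W hWone hWmul
  obtain ⟨M, P₀, hM, hb1', hb2'⟩ := exists_prime_bounds a c (ψ.coeff 0) ψ.const hWa hα0 ha0 hΔ
  have hb1 : ∀ p k : ℕ, p.Prime → 1 ≤ k → |b (p ^ k)| ≤ M := fun p k hp hk => by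
    rw [hbp p k hp hk]; exact hb1' p hp
  have hb2 : ∀ p k : ℕ, p.Prime → 1 ≤ k → P₀ < p → |b (p ^ k)| ≤ M / p := fun p k hp hk hP => by
    rw [hbp p k hp hk]; exact hb2' p hp hP
  obtain ⟨S, hS⟩ := exists_sum_abs_div_sqrt_le_of_bounds b hbm hM hb1 hb2
  have hbμ' : ∀ d : ℕ, (b * (μ : ArithmeticFunction ℝ)) d = (μ d : ℝ) * d * W d := fun d => by
    rw [hbμ, hG]
  -- part 4: the truncated Möbius sums
  obtain ⟨C₁, hC₁⟩ := exists_bound_sum_moebius_weight W hW0 hW1 b hbμ' hS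
  obtain ⟨C₂, hC₂⟩ := exists_bound_sum_moebius_weight_log W hW0 hW1 b hbμ' hS
  obtain ⟨C₃, hC₃⟩ := exists_bound_sum_moebius_weight_log_add W hW0 hW1 b hbμ' hS
  -- part 3: `𝔖(vecCons ψ Φ) = H₀ 𝔖(Φ)` with `H₀ = ∑_n b(n)/n`
  have hsum : Summable fun n : ℕ => ‖b n / n‖ := summable_norm_div_of_sum_le b hS
  have hr := tendsto_prod_primesLE_eulerFactor b hbm hsum W hbp
  have hloc : ∀ p : ℕ, p.Prime → localFactor (Matrix.vecCons ψ Φ) p =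
      ((p : ℝ) / (p - 1) * (1 - W p)) * localFactor Φ p := fun p hp =>
    localFactor_vecCons Φ ψ hp (W p) (weight_prime_mul_card a c (ψ.coeff 0) ψ.const hWa hp)
  have hSid : singularProduct (Matrix.vecCons ψ Φ) = (∑' n : ℕ, b n / n) * singularProduct Φ :=
    singularProduct_vecCons Φ ψ hnd _ _ hr hloc
  -- assembly
  refine ⟨max C₁ (max C₂ (|singularProduct Φ| * C₃)), fun x hx => ⟨?_, ?_, ?_⟩⟩
  · exact (hC₁ x hx).trans (div_le_div_of_nonneg_right (le_max_left _ _) (sq_nonneg _))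
  · exact (hC₂ x hx).trans (le_max_of_le_right (le_max_left _ _))
  · have hlog : 0 ≤ Real.log x := Real.log_nonneg (by exact_mod_cast (by omega : 1 ≤ x))
    rw [hSid, show singularProduct Φ * (∑ d ∈ Icc 1 x, (μ d : ℝ) * W d * Real.log d) +
        (∑' n : ℕ, b n / n) * singularProduct Φ = singularProduct Φ *
          (∑ d ∈ Icc 1 x, (μ d : ℝ) * W d * Real.log d + ∑' n : ℕ, b n / n) by ring, abs_mul]
    calc |singularProduct Φ| * |∑ d ∈ Icc 1 x, (μ d : ℝ) * W d * Real.log d + ∑' n : ℕ, b n / n|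
        ≤ |singularProduct Φ| * (C₃ / Real.log x) :=
          mul_le_mul_of_nonneg_left (hC₃ x hx) (abs_nonneg _)
      _ = |singularProduct Φ| * C₃ / Real.log x := by ring
      _ ≤ max C₁ (max C₂ (|singularProduct Φ| * C₃)) / Real.log x :=
          div_le_div_of_nonneg_right (le_max_of_le_right (le_max_right _ _)) hlog

/-! ### The registered stub -/

/-- **`stub_slopedEuler` — the singular-series identity of the rung.** For `t ≥ 1`, a positive
`t`-system `Φ` and a positive form `ψ` with `vecCons ψ Φ` non-degenerate, and the weight
`w̃(d) = ∑_{ρ < d'} 𝟙[d ∣ ψ(ρ)] 𝟙[ρ Φ-admissible mod d'] / #{Φ-admissible mod d'}` (`d' = d/gcd(ψ̇, d)`),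
there is `C` with `|∑_{d ≤ x} μ(d) w̃(d)| ≤ C/(log x)²`, `|∑_{d ≤ x} μ(d) w̃(d) log d| ≤ C` and
`|𝔖(Φ) ∑_{d ≤ x} μ(d) w̃(d) log d + 𝔖(vecCons ψ Φ)| ≤ C/log x` for all `x ≥ 2`
(`slopedEuler_main`). [folklore] -/
theorem stub_slopedEuler :
    ∀ t : ℕ, 1 ≤ t → ∀ (Φ : Fin t → Literature.NumberTheory.Sieve.AffLinForm 1) (ψ : Literature.NumberTheory.Sieve.AffLinForm 1), Literature.NumberTheory.Sieve.IsNondegenerateSystem (Matrix.vecCons ψ Φ) → (∀ i, 0 < (Φ i).coeff 0 ∧ 0 ≤ (Φ i).const) → (0 < ψ.coeff 0 ∧ 0 ≤ ψ.const) → ∃ C : ℝ, ∀ x : ℕ, 2 ≤ x → |∑ d ∈ Finset.Icc 1 x, (ArithmeticFunction.moebius d : ℝ) * (∑ ρ ∈ Finset.range (d / Int.gcd (ψ.coeff 0) d), if (d : ℤ) ∣ ψ.eval ![(ρ : ℤ)] then (if ∀ i, Int.gcd ((Φ i).eval ![(ρ : ℤ)]) (d / Int.gcd (ψ.coeff 0)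 d) = 1 then ((((Finset.range (d / Int.gcd (ψ.coeff 0) d)).filter (fun ρ' : ℕ => ∀ i, Int.gcd ((Φ i).eval ![(ρ' : ℤ)]) (d / Int.gcd (ψ.coeff 0) d) = 1)).card : ℝ))⁻¹ else 0) else (0 : ℝ))| ≤ C / Real.log x ^ 2 ∧ |∑ d ∈ Finset.Icc 1 x, (ArithmeticFunction.moebius d : ℝ) * (∑ ρ ∈ Finset.range (d / Int.gcd (ψ.coeff 0) d), if (d : ℤ) ∣ ψ.eval ![(ρ : ℤ)] then (if ∀ i, Int.gcd ((Φ i).eval ![(ρ : ℤ)]) (d / Int.gcd (ψ.coeff 0) d) = 1 then ((((Finset.range (d / Int.gcd (ψ.coeff 0) d)).filter (fun ρ' : ℕ => ∀ i, Int.gcd ((Φ i).eval ![(ρ' : ℤ)]) (d / Int.gcd (ψ.coeff 0) d) = 1)).card : ℝ))⁻¹ else 0) else (0 : ℝ)) * Real.log d| ≤ C ∧ |Literature.NumberTheory.Sieve.singularProduct Φ * (∑ d ∈ Finset.Icc 1 x, (ArithmeticFunction.moebius d : ℝ) * (∑ ρ ∈ Finset.range (d / Int.gcd (ψ.coeff 0)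 d), if (d : ℤ) ∣ ψ.eval ![(ρ : ℤ)] then (if ∀ i, Int.gcd ((Φ i).eval ![(ρ : ℤ)]) (d / Int.gcd (ψ.coeff 0) d) = 1 then ((((Finset.range (d / Int.gcd (ψ.coeff 0) d)).filter (fun ρ' : ℕ => ∀ i, Int.gcd ((Φ i).eval ![(ρ' : ℤ)]) (d / Int.gcd (ψ.coeff 0) d) = 1)).card : ℝ))⁻¹ else 0) else (0 : ℝ)) * Real.log d) + Literature.NumberTheory.Sieve.singularProduct (Matrix.vecCons ψ Φ)| ≤ C / Real.log x := by
  intro t _ Φ ψ hnd hΦ hψ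
  obtain ⟨C, hC⟩ := slopedEuler_main Φ ψ hnd hΦ hψ
    (fun d : ℕ => ∑ ρ ∈ range (d / Int.gcd (ψ.coeff 0) d),
      if (d : ℤ) ∣ ψ.coeff 0 * ρ + ψ.const then
        (if ∀ i, Int.gcd ((Φ i).coeff 0 * ρ + (Φ i).const) (d / Int.gcd (ψ.coeff 0) d : ℕ) = 1 then
          ((#((range (d / Int.gcd (ψ.coeff 0) d)).filter (fun ρ' : ℕ =>
            ∀ i, Int.gcd ((Φ i).coeff 0 * ρ' + (Φ i).const) (d / Int.gcd (ψ.coeff 0) d : ℕ) = 1)) :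
              ℝ))⁻¹
        else 0)
      else 0)
    (fun _ => rfl)
  refine ⟨C, fun x hx => ?_⟩
  have e : ∀ d : ℕ, (∑ ρ ∈ Finset.range (d / Int.gcd (ψ.coeff 0) d), if (d : ℤ) ∣ ψ.eval ![(ρ : ℤ)] then (if ∀ i, Int.gcd ((Φ i).eval ![(ρ : ℤ)]) (d / Int.gcd (ψ.coeff 0) d) = 1 then ((((Finset.range (d / Int.gcd (ψ.coeff 0) d)).filter (fun ρ' : ℕ => ∀ i, Int.gcd ((Φ i).eval ![(ρ' : ℤ)]) (d / Int.gcd (ψ.coeff 0) d) = 1)).card : ℝ))⁻¹ else 0) else (0 : ℝ)) =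
      ∑ ρ ∈ range (d / Int.gcd (ψ.coeff 0) d),
        if (d : ℤ) ∣ ψ.coeff 0 * ρ + ψ.const then
          (if ∀ i, Int.gcd ((Φ i).coeff 0 * ρ + (Φ i).const) (d / Int.gcd (ψ.coeff 0) d : ℕ) = 1 then
            ((#((range (d / Int.gcd (ψ.coeff 0) d)).filter (fun ρ' : ℕ =>
              ∀ i, Int.gcd ((Φ i).coeff 0 * ρ' + (Φ i).const) (d / Int.gcd (ψ.coeff 0) d : ℕ) = 1)) :
                ℝ))⁻¹
          else 0)
        else 0 := fun d => by
    rw [← Int.natCast_div]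
    simp only [eval_vecSingle]
  simp only [e]
  exact hC x hx

end Summit.Parity.GeneralizedHardyLittlewood.Theorems.PairsToGHL.SlopedLadder
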